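import Summits.QuantumFields.YangMills.Theorems.EntropyBudgetEquipartitionCovTransferTorus
import HarnessLib

/-!
# Route `EntropyBudgetEquipartition`, crux `EntropyBudgetTransfer` (stmt-QuantumFields-22401) — helper «KT3 → KT»,
# part 6: the MINIMAL hypothesis — three clipped moments — and its COUPLING form (stable under perturbing the observable)

HONEST LABEL: bookkeeping toward a RECORD-label rung (R2ξ-G, `WeakCouplingRates.XiPow`); the Yang–Mills mass gap is NOT
proved by any of this, and neither is the crux.

The truncation argument of parts 1–5 tests the pair laws only through the three CLIPPED MOMENTS `E[(X∧m)(Y∧m)]`, `E[X∧m]`,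
`E[Y∧m]`.  This part states the transfer with exactly that hypothesis — `abs_cov_sub_cov_le_of_clippedMoments`,
`covTransfer_torus_of_clippedMoments` (torus vocabulary of item 22401, `μ`-tails again by the tree's chessboard tail) — and derives
it from a COUPLING: `abs_clippedMoments_sub_le_of_coupling` — if the two pairs live on ONE probability space with
`E|X − X'| ≤ ε`, `E|Y − Y'| ≤ ε`, the clipped moments agree within `2mε`, `ε`, `ε` (clips are `1`-Lipschitz and bounded by `m`).
Unlike total variation (parts 1–3), the coupling / bounded-Lipschitz currency IS stable under perturbing the observable: the quartic
remainder `β(cost∘exp − ½|F|²) = O(β|a|⁴)` is itself a deterministic coupling with `E|·| = O(β^{−1})`, and Pinsker + maximal coupling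
turn a relative-entropy bound `D` into `E|X − X'| ≤ 2M√(D/2)`.  So KT2 + KT3 may deliver EITHER currency; the covariance conclusion
is the same.  Written by the width seat 2/3 of line `ym-line-ebe-p1` as `--supports stmt-QuantumFields-22401`. [folklore]
-/

set_option autoImplicit false

noncomputable section

open MeasureTheory Set Filter

namespace Summit.QuantumFields.YangMills.Theorems.EntropyBudgetEquipartition.CovTransfer

/-! ### Abstract part: clipped moments -/

section TwoMeasures

variable {E E' : Type*} [MeasurableSpace E] [MeasurableSpace E'] {P : Measure E} {Q : Measure E'}
  [IsProbabilityMeasure P] [IsProbabilityMeasure Q]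

/-- **Clipped covariances from clipped moments**: if `|E_P[(X∧m)(Y∧m)] − E_Q[(X'∧m)(Y'∧m)]| ≤ δ₁` and the clipped first
moments agree within `δ₂`, then for `Y, X' ≥ 0` and `m ≥ 0`
`|Cov_P(X∧m, Y∧m) − Cov_Q(X'∧m, Y'∧m)| ≤ δ₁ + 2 m δ₂`. [folklore] -/
theorem abs_cov_min_sub_cov_min_le_of_clippedMoments {X Y : E → ℝ} {X' Y' : E' → ℝ}
    (hY0 : ∀ e, 0 ≤ Y e) (hX'0 : ∀ e, 0 ≤ X' e) {m δ₁ δ₂ : ℝ} (hm : 0 ≤ m)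
    (h11 : |∫ e, min (X e) m * min (Y e) m ∂P - ∫ e, min (X' e) m * min (Y' e) m ∂Q| ≤ δ₁)
    (h1 : |∫ e, min (X e) m ∂P - ∫ e, min (X' e) m ∂Q| ≤ δ₂)
    (h2 : |∫ e, min (Y e) m ∂P - ∫ e, min (Y' e) m ∂Q| ≤ δ₂) :
    |(∫ e, min (X e) m * min (Y e) m ∂P - (∫ e, min (X e) m ∂P) * (∫ e, min (Y e) m ∂P)) -
        (∫ e, min (X' e) m * min (Y' e) m ∂Q - (∫ e, min (X' e) m ∂Q) * (∫ e, min (Y' e) m ∂Q))| ≤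
      δ₁ + 2 * m * δ₂ := by
  have bP : |∫ e, min (Y e) m ∂P| ≤ m := by
    rw [abs_of_nonneg (integral_nonneg fun e => le_min (hY0 e) hm)]
    calc ∫ e, min (Y e) m ∂P ≤ ∫ e, m ∂P := integral_mono_of_nonneg (ae_of_all _ fun e => le_min (hY0 e) hm)
          (integrable_const m) (ae_of_all _ fun e => min_le_right _ _)
      _ = m := by simp
  have bQ : |∫ e, min (X' e) m ∂Q| ≤ m := by
    rw [abs_of_nonneg (integral_nonneg fun e => le_min (hX'0 e) hm)]
    calc ∫ e, min (X' e) m ∂Q ≤ ∫ e, m ∂Q := integral_mono_of_nonneg (ae_of_all _ fun e => le_min (hX'0 e) hm)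
          (integrable_const m) (ae_of_all _ fun e => min_le_right _ _)
      _ = m := by simp
  have hprod : |(∫ e, min (X e) m ∂P) * (∫ e, min (Y e) m ∂P) - (∫ e, min (X' e) m ∂Q) * (∫ e, min (Y' e) m ∂Q)|
      ≤ 2 * m * δ₂ := by
    have e1 : (∫ e, min (X e) m ∂P) * (∫ e, min (Y e) m ∂P) - (∫ e, min (X' e) m ∂Q) * (∫ e, min (Y' e) m ∂Q) =
        (∫ e, min (X e) m ∂P - ∫ e, min (X' e) m ∂Q) * (∫ e, min (Y e) m ∂P) +
          (∫ e, min (X' e) m ∂Q) * (∫ e, min (Y e) m ∂P - ∫ e, min (Y' e) m ∂Q) := by ring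
    rw [e1]
    refine (abs_add_le _ _).trans ?_
    rw [abs_mul, abs_mul]
    have t1 : |∫ e, min (X e) m ∂P - ∫ e, min (X' e) m ∂Q| * |∫ e, min (Y e) m ∂P| ≤ δ₂ * m :=
      mul_le_mul h1 bP (abs_nonneg _) ((abs_nonneg _).trans h1)
    have t2 : |∫ e, min (X' e) m ∂Q| * |∫ e, min (Y e) m ∂P - ∫ e, min (Y' e) m ∂Q| ≤ m * δ₂ :=
      mul_le_mul bQ h2 (abs_nonneg _) ((abs_nonneg _).trans bQ)
    nlinarith
  have e2 : (∫ e, min (X e) m * min (Y e) m ∂P - (∫ e, min (X e) m ∂P) * (∫ e, min (Y e) m ∂P)) -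
        (∫ e, min (X' e) m * min (Y' e) m ∂Q - (∫ e, min (X' e) m ∂Q) * (∫ e, min (Y' e) m ∂Q)) =
      (∫ e, min (X e) m * min (Y e) m ∂P - ∫ e, min (X' e) m * min (Y' e) m ∂Q) -
        ((∫ e, min (X e) m ∂P) * (∫ e, min (Y e) m ∂P) - (∫ e, min (X' e) m ∂Q) * (∫ e, min (Y' e) m ∂Q)) := by
    ring
  rw [e2]
  exact (abs_sub _ _).trans (by linarith)

/-- **Covariance transfer from clipped moments** (the minimal hypothesis of the truncation argument): two probability spaces,
non-negative observables bounded by `M`; clipped mixed moment within `δ₁`, clipped first moments within `δ₂`, level `m > 0` ⇒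
`|Cov_P(X,Y) − Cov_Q(X',Y')| ≤ δ₁ + 2mδ₂ + 2M²(P{m<X} + P{m<Y} + Q{m<X'} + Q{m<Y'})`. [folklore] -/
theorem abs_cov_sub_cov_le_of_clippedMoments {X Y : E → ℝ} {X' Y' : E' → ℝ} (hX : Measurable X) (hY : Measurable Y)
    (hX' : Measurable X') (hY' : Measurable Y') {M : ℝ} (hM : 0 ≤ M)
    (hX0 : ∀ e, 0 ≤ X e) (hXM : ∀ e, X e ≤ M) (hY0 : ∀ e, 0 ≤ Y e) (hYM : ∀ e, Y e ≤ M)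
    (hX'0 : ∀ e, 0 ≤ X' e) (hX'M : ∀ e, X' e ≤ M) (hY'0 : ∀ e, 0 ≤ Y' e) (hY'M : ∀ e, Y' e ≤ M)
    {m δ₁ δ₂ : ℝ} (hm : 0 < m)
    (h11 : |∫ e, min (X e) m * min (Y e) m ∂P - ∫ e, min (X' e) m * min (Y' e) m ∂Q| ≤ δ₁)
    (h1 : |∫ e, min (X e) m ∂P - ∫ e, min (X' e) m ∂Q| ≤ δ₂)
    (h2 : |∫ e, min (Y e) m ∂P - ∫ e, min (Y' e) m ∂Q| ≤ δ₂) :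
    |(∫ e, X e * Y e ∂P - (∫ e, X e ∂P) * (∫ e, Y e ∂P)) -
        (∫ e, X' e * Y' e ∂Q - (∫ e, X' e ∂Q) * (∫ e, Y' e ∂Q))| ≤
      (δ₁ + 2 * m * δ₂) + 2 * M ^ 2 * (P.real {e | m < X e} + P.real {e | m < Y e} +
        Q.real {e | m < X' e} + Q.real {e | m < Y' e}) := by
  have hP := abs_cov_sub_cov_min_le (P := P) hX hY hM hX0 hXM hY0 hYM hm.le
  have hQ := abs_cov_sub_cov_min_le (P := Q) hX' hY' hM hX'0 hX'M hY'0 hY'M hm.le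
  have hPQ := abs_cov_min_sub_cov_min_le_of_clippedMoments (P := P) (Q := Q) hY0 hX'0 hm.le h11 h1 h2
  rw [abs_le] at hP hQ hPQ ⊢
  constructor <;> nlinarith [hP.1, hP.2, hQ.1, hQ.2, hPQ.1, hPQ.2]

end TwoMeasures

/-! ### Abstract part: couplings -/

section Coupling

variable {Ω : Type*} [MeasurableSpace Ω] {π : Measure Ω} [IsProbabilityMeasure π]

/-- **Clipped moments from a coupling.** On ONE probability space, if `X, Y, X', Y' ≥ 0`, `E|X − X'| ≤ ε`, `E|Y − Y'| ≤ ε`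
(all four integrable), then for `m ≥ 0`: `|E[(X∧m)(Y∧m)] − E[(X'∧m)(Y'∧m)]| ≤ 2mε`, `|E[X∧m] − E[X'∧m]| ≤ ε`,
`|E[Y∧m] − E[Y'∧m]| ≤ ε`. [folklore] -/
theorem abs_clippedMoments_sub_le_of_coupling {X Y X' Y' : Ω → ℝ} (hX : Measurable X) (hY : Measurable Y)
    (hX' : Measurable X') (hY' : Measurable Y') (hX0 : ∀ ω, 0 ≤ X ω) (hY0 : ∀ ω, 0 ≤ Y ω) (hX'0 : ∀ ω, 0 ≤ X' ω)
    (hY'0 : ∀ ω, 0 ≤ Y' ω) (iX : Integrable (fun ω => X ω - X' ω) π) (iY : Integrable (fun ω => Y ω - Y' ω) π)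
    {m ε : ℝ} (hm : 0 ≤ m) (hεX : ∫ ω, |X ω - X' ω| ∂π ≤ ε) (hεY : ∫ ω, |Y ω - Y' ω| ∂π ≤ ε) :
    |∫ ω, min (X ω) m * min (Y ω) m ∂π - ∫ ω, min (X' ω) m * min (Y' ω) m ∂π| ≤ 2 * m * ε ∧
      |∫ ω, min (X ω) m ∂π - ∫ ω, min (X' ω) m ∂π| ≤ ε ∧
      |∫ ω, min (Y ω) m ∂π - ∫ ω, min (Y' ω) m ∂π| ≤ ε := by
  -- integrability of the clips (bounded by `m`, non-negative)
  have bnd : ∀ {Z : Ω → ℝ}, Measurable Z → (∀ ω, 0 ≤ Z ω) → Integrable (fun ω => min (Z ω) m) π := by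
    intro Z hZ hZ0
    exact Integrable.of_bound (hZ.min measurable_const).aestronglyMeasurable m (ae_of_all _ fun ω => by
      rw [Real.norm_eq_abs, abs_of_nonneg (le_min (hZ0 ω) hm)]; exact min_le_right _ _)
  -- clipping to `[·, m]` is `1`-Lipschitz (the tree's `ExtCollar.abs_min_sub_min_le`, via Mathlib's `abs_min_sub_min_le_max`)
  have abs_min_sub_min_le : ∀ x x' : ℝ, |min x m - min x' m| ≤ |x - x'| := fun x x' =>
    (abs_min_sub_min_le_max x m x' m).trans (by simp)
  have cX := bnd hX hX0
  have cY := bnd hY hY0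
  have cX' := bnd hX' hX'0
  have cY' := bnd hY' hY'0
  have cXY : Integrable (fun ω => min (X ω) m * min (Y ω) m) π :=
    Integrable.of_bound ((hX.min measurable_const).mul (hY.min measurable_const)).aestronglyMeasurable (m * m)
      (ae_of_all _ fun ω => by
        rw [Real.norm_eq_abs, abs_of_nonneg (mul_nonneg (le_min (hX0 ω) hm) (le_min (hY0 ω) hm))]
        exact mul_le_mul (min_le_right _ _) (min_le_right _ _) (le_min (hY0 ω) hm) hm)
  have cXY' : Integrable (fun ω => min (X' ω) m * min (Y' ω) m) π :=
    Integrable.of_bound ((hX'.min measurable_const).mul (hY'.min measurable_const)).aestronglyMeasurable (m * m)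
      (ae_of_all _ fun ω => by
        rw [Real.norm_eq_abs, abs_of_nonneg (mul_nonneg (le_min (hX'0 ω) hm) (le_min (hY'0 ω) hm))]
        exact mul_le_mul (min_le_right _ _) (min_le_right _ _) (le_min (hY'0 ω) hm) hm)
  refine ⟨?_, ?_, ?_⟩
  · rw [← integral_sub cXY cXY']
    calc |∫ ω, (min (X ω) m * min (Y ω) m - min (X' ω) m * min (Y' ω) m) ∂π|
        ≤ ∫ ω, |min (X ω) m * min (Y ω) m - min (X' ω) m * min (Y' ω) m| ∂π := abs_integral_le_integral_abs
      _ ≤ ∫ ω, (m * |X ω - X' ω| + m * |Y ω - Y' ω|) ∂π := by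
          refine integral_mono (cXY.sub cXY').abs ((iX.abs.const_mul m).add (iY.abs.const_mul m)) fun ω => ?_
          have e1 : min (X ω) m * min (Y ω) m - min (X' ω) m * min (Y' ω) m =
              (min (X ω) m - min (X' ω) m) * min (Y ω) m + min (X' ω) m * (min (Y ω) m - min (Y' ω) m) := by ring
          rw [e1]
          refine (abs_add_le _ _).trans ?_
          rw [abs_mul, abs_mul, abs_of_nonneg (le_min (hY0 ω) hm), abs_of_nonneg (le_min (hX'0 ω) hm)]
          have a1 := abs_min_sub_min_le (X ω) (X' ω)
          have a2 := abs_min_sub_min_le (Y ω) (Y' ω)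
          have b1 : 0 ≤ min (Y ω) m := le_min (hY0 ω) hm
          have b2 : 0 ≤ min (X' ω) m := le_min (hX'0 ω) hm
          nlinarith [min_le_right (Y ω) m, min_le_right (X' ω) m, abs_nonneg (X ω - X' ω), abs_nonneg (Y ω - Y' ω),
            mul_le_mul a1 (min_le_right (Y ω) m) b1 (abs_nonneg _),
            mul_le_mul (min_le_right (X' ω) m) a2 (abs_nonneg _) hm]
      _ = m * ∫ ω, |X ω - X' ω| ∂π + m * ∫ ω, |Y ω - Y' ω| ∂π := by
          rw [integral_add (iX.abs.const_mul m) (iY.abs.const_mul m), integral_const_mul, integral_const_mul]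
      _ ≤ 2 * m * ε := by nlinarith [mul_le_mul_of_nonneg_left hεX hm, mul_le_mul_of_nonneg_left hεY hm]
  · rw [← integral_sub cX cX']
    calc |∫ ω, (min (X ω) m - min (X' ω) m) ∂π| ≤ ∫ ω, |min (X ω) m - min (X' ω) m| ∂π := abs_integral_le_integral_abs
      _ ≤ ∫ ω, |X ω - X' ω| ∂π := integral_mono (cX.sub cX').abs iX.abs fun ω => abs_min_sub_min_le _ _
      _ ≤ ε := hεX
  · rw [← integral_sub cY cY']
    calc |∫ ω, (min (Y ω) m - min (Y' ω) m) ∂π| ≤ ∫ ω, |min (Y ω) m - min (Y' ω) m| ∂π := abs_integral_le_integral_abs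
      _ ≤ ∫ ω, |Y ω - Y' ω| ∂π := integral_mono (cY.sub cY').abs iY.abs fun ω => abs_min_sub_min_le _ _
      _ ≤ ε := hεY

end Coupling

/-! ### Torus part -/

section Torus

open Literature.MathematicalPhysics.QuantumFieldTheory Literature.MathematicalPhysics.QuantumLattice
open Summit.QuantumFields.YangMills.Theorems.WeakCouplingRates
open Summit.QuantumFields.YangMills.Theorems.ColdBoxAllGroups (measureReal_plaqCost_ge_le_allSidesG)

variable {G : Type} [Group G] [TopologicalSpace G] [IsTopologicalGroup G] [CompactSpace G]
  [MeasurableSpace G] [BorelSpace G]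

/-- **Covariance transfer for the torus Wilson state from CLIPPED MOMENTS** (as `covTransfer_torus`, with the closeness hypothesis
replaced by the three clipped-moment comparisons at the level `m`: the mixed one within `δ₁`, the two first ones within `δ₂`):
`|β² Cov_{β,L+1}(c₀, c_n) − Cov_Q(X', Y')| ≤ (δ₁ + 2mδ₂) + C β^{κ+2} e^{−m/2} + 8(Nβ)² (Q{m < X'} + Q{m < Y'})`.
[cite: FrohlichIsraelLiebSimon1978, Thm. 4.1] -/
theorem covTransfer_torus_of_clippedMoments (r : LatticeRep G) :
    ∃ C : ℝ, 0 < C ∧ ∃ κ : ℕ, ∀ (L : ℕ), 1 ≤ L → ∀ (β : ℝ), 1 ≤ β → ∀ (n : ℕ)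
      {E' : Type*} [MeasurableSpace E'] (Q : Measure E') [IsProbabilityMeasure Q] (X' Y' : E' → ℝ),
      Measurable X' → Measurable Y' → (∀ e, 0 ≤ X' e) → (∀ e, X' e ≤ 2 * r.N * β) →
      (∀ e, 0 ≤ Y' e) → (∀ e, Y' e ≤ 2 * r.N * β) →
      ∀ (m δ₁ δ₂ : ℝ), 0 < m →
      |wilsonExpectation (L := L + 1) r.ρ β (toTorusObservable (L + 1) fun U =>
            min (β * plaqCost0 (d := 4) r.ρ 1 2 U) m * min (β * plaqCost0 (d := 4) r.ρ 1 2 (timeShiftLG (G := G) n U)) m) -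
          ∫ e, min (X' e) m * min (Y' e) m ∂Q| ≤ δ₁ →
      |wilsonExpectation (L := L + 1) r.ρ β (toTorusObservable (L + 1) fun U =>
            min (β * plaqCost0 (d := 4) r.ρ 1 2 U) m) - ∫ e, min (X' e) m ∂Q| ≤ δ₂ →
      |wilsonExpectation (L := L + 1) r.ρ β (toTorusObservable (L + 1) fun U =>
            min (β * plaqCost0 (d := 4) r.ρ 1 2 (timeShiftLG (G := G) n U)) m) - ∫ e, min (Y' e) m ∂Q| ≤ δ₂ →
      |β ^ 2 * (wilsonExpectation (L := L + 1) r.ρ β (toTorusObservable (L + 1) fun U =>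
              plaqCost0 (d := 4) r.ρ 1 2 U * plaqCost0 (d := 4) r.ρ 1 2 (timeShiftLG (G := G) n U)) -
            wilsonExpectation (L := L + 1) r.ρ β (toTorusObservable (L + 1) (plaqCost0 (d := 4) r.ρ 1 2)) *
              wilsonExpectation (L := L + 1) r.ρ β (toTorusObservable (L + 1) fun U =>
                plaqCost0 (d := 4) r.ρ 1 2 (timeShiftLG (G := G) n U))) -
          (∫ e, X' e * Y' e ∂Q - (∫ e, X' e ∂Q) * (∫ e, Y' e ∂Q))| ≤
        (δ₁ + 2 * m * δ₂) + C * β ^ (κ + 2) * Real.exp (-(m / 2)) +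
          8 * ((r.N : ℝ) * β) ^ 2 * (Q.real {e | m < X' e} + Q.real {e | m < Y' e}) := by
  haveI : SecondCountableTopology G := r.secondCountableTopology
  obtain ⟨C, hC, κ, htail⟩ := measureReal_plaqCost_ge_le_allSidesG r
  refine ⟨16 * (r.N : ℝ) ^ 2 * C + 1, by positivity, κ, ?_⟩
  intro L hL β hβ n E' _ Q _ X' Y' hX'm hY'm hX'0 hX'M hY'0 hY'M m δ₁ δ₂ hm h11 h1 h2
  have hβ0 : 0 < β := lt_of_lt_of_le one_pos hβ
  set ρ := r.ρ with hρdef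
  set P : Measure (GaugeConfig 4 (L + 1) G) := wilsonMeasure (d := 4) (L := L + 1) ρ β with hP
  haveI : IsProbabilityMeasure P := isProbabilityMeasure_wilsonMeasure (d := 4) (L := L + 1) ρ r.continuous β
  -- the two observables on the torus
  set X : GaugeConfig 4 (L + 1) G → ℝ := fun U => β * plaqCost0 (d := 4) ρ 1 2 (torusLift (L + 1) U) with hXd
  set Y : GaugeConfig 4 (L + 1) G → ℝ :=
    fun U => β * plaqCost0 (d := 4) ρ 1 2 (timeShiftLG (G := G) n (torusLift (L + 1) U)) with hYd
  have hc : Continuous (plaqCost0 (d := 4) (G := G) ρ 1 2) := (continuous_bounded_plaqCost0 ρ r.continuous 1 2).1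
  have hXm : Measurable X :=
    (continuous_const.mul (hc.comp (continuous_torusLift (L + 1)))).measurable
  have hYm : Measurable Y :=
    (continuous_const.mul (hc.comp ((continuous_timeShiftLG n).comp (continuous_torusLift (L + 1))))).measurable
  have hM : (0 : ℝ) ≤ 2 * r.N * β := by positivity
  have hXb : ∀ U, 0 ≤ X U ∧ X U ≤ 2 * r.N * β := fun U => by
    obtain ⟨h0, h2⟩ := plaqCost0_mem ρ r.mem_unitary 1 2 (torusLift (L + 1) U)
    exact ⟨mul_nonneg hβ0.le h0, by rw [hXd]; nlinarith⟩
  have hYb : ∀ U, 0 ≤ Y U ∧ Y U ≤ 2 * r.N * β := fun U => by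
    obtain ⟨h0, h2⟩ := plaqCost0_mem ρ r.mem_unitary 1 2 (timeShiftLG (G := G) n (torusLift (L + 1) U))
    exact ⟨mul_nonneg hβ0.le h0, by rw [hYd]; nlinarith⟩
  -- the clipped moments, in integral form
  have h11' : |∫ U, min (X U) m * min (Y U) m ∂P - ∫ e, min (X' e) m * min (Y' e) m ∂Q| ≤ δ₁ := by
    simpa only [wilsonExpectation, toTorusObservable_apply] using h11
  have h1' : |∫ U, min (X U) m ∂P - ∫ e, min (X' e) m ∂Q| ≤ δ₂ := by
    simpa only [wilsonExpectation, toTorusObservable_apply] using h1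
  have h2' : |∫ U, min (Y U) m ∂P - ∫ e, min (Y' e) m ∂Q| ≤ δ₂ := by
    simpa only [wilsonExpectation, toTorusObservable_apply] using h2
  -- the abstract transfer
  have habs := abs_cov_sub_cov_le_of_clippedMoments (P := P) (Q := Q) hXm hYm hX'm hY'm hM (fun U => (hXb U).1)
    (fun U => (hXb U).2) (fun U => (hYb U).1) (fun U => (hYb U).2) hX'0 hX'M hY'0 hY'M hm h11' h1' h2'
  -- the μ-side tails
  have hL2 : 2 ≤ L + 1 := by omega
  have hs : 0 ≤ m / β := div_nonneg hm.le hβ0.le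
  have h12 : (1 : Fin 4) ≠ 2 := by decide
  have tX : P.real {U | m < X U} ≤ C * β ^ κ * Real.exp (-(m / 2)) := by
    have hsub : {U | m < X U} ⊆ {U : GaugeConfig 4 (L + 1) G |
        m / β ≤ (r.N : ℝ) - (r.ρ (plaquetteHolonomy U 0 1 2)).trace.re} := by
      intro U hU
      simp only [Set.mem_setOf_eq] at hU ⊢
      rw [hXd] at hU
      simp only [plaqCost0_torusLift] at hU
      rw [div_le_iff₀ hβ0]
      linarith
    have h1 := htail (L := L + 1) hL2 β hβ (m / β) hs (0 : Site 4 (L + 1)) h12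
    have e1 : β * (m / β) / 2 = m / 2 := by field_simp
    rw [e1] at h1
    exact (measureReal_mono hsub).trans h1
  have tY : P.real {U | m < Y U} ≤ C * β ^ κ * Real.exp (-(m / 2)) := by
    have hsub : {U | m < Y U} ⊆ {U : GaugeConfig 4 (L + 1) G |
        m / β ≤ (r.N : ℝ) - (r.ρ (plaquetteHolonomy U
          (Literature.Probability.LatticeModels.Torus.proj (L + 1) (Pi.single 0 (n : ℤ))) 1 2)).trace.re} := by
      intro U hU
      simp only [Set.mem_setOf_eq] at hU ⊢
      rw [hYd] at hU
      simp only [plaqCost0_timeShiftLG_torusLift] at hU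
      rw [div_le_iff₀ hβ0]
      linarith
    have h1 := htail (L := L + 1) hL2 β hβ (m / β) hs
      (Literature.Probability.LatticeModels.Torus.proj (L + 1) (Pi.single 0 (n : ℤ))) h12
    have e1 : β * (m / β) / 2 = m / 2 := by field_simp
    rw [e1] at h1
    exact (measureReal_mono hsub).trans h1
  -- rewrite the goal in terms of `X`, `Y`
  have iXY : ∫ U, X U * Y U ∂P = β ^ 2 * wilsonExpectation (L := L + 1) ρ β (toTorusObservable (L + 1) fun U =>
      plaqCost0 (d := 4) ρ 1 2 U * plaqCost0 (d := 4) ρ 1 2 (timeShiftLG (G := G) n U)) := by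
    simp only [wilsonExpectation, toTorusObservable_apply, hXd, hYd, hP, ← integral_const_mul]
    congr 1; funext U; ring
  have iX : ∫ U, X U ∂P = β * wilsonExpectation (L := L + 1) ρ β (toTorusObservable (L + 1) (plaqCost0 (d := 4) ρ 1 2)) := by
    simp only [wilsonExpectation, toTorusObservable_apply, hXd, hP, ← integral_const_mul]
  have iY : ∫ U, Y U ∂P = β * wilsonExpectation (L := L + 1) ρ β (toTorusObservable (L + 1) fun U =>
      plaqCost0 (d := 4) ρ 1 2 (timeShiftLG (G := G) n U)) := by
    simp only [wilsonExpectation, toTorusObservable_apply, hYd, hP, ← integral_const_mul]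
  rw [iXY, iX, iY] at habs
  have e3 : β ^ 2 * (wilsonExpectation (L := L + 1) ρ β (toTorusObservable (L + 1) fun U =>
              plaqCost0 (d := 4) ρ 1 2 U * plaqCost0 (d := 4) ρ 1 2 (timeShiftLG (G := G) n U)) -
            wilsonExpectation (L := L + 1) ρ β (toTorusObservable (L + 1) (plaqCost0 (d := 4) ρ 1 2)) *
              wilsonExpectation (L := L + 1) ρ β (toTorusObservable (L + 1) fun U =>
                plaqCost0 (d := 4) ρ 1 2 (timeShiftLG (G := G) n U))) =
      β ^ 2 * wilsonExpectation (L := L + 1) ρ β (toTorusObservable (L + 1) fun U =>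
              plaqCost0 (d := 4) ρ 1 2 U * plaqCost0 (d := 4) ρ 1 2 (timeShiftLG (G := G) n U)) -
        β * wilsonExpectation (L := L + 1) ρ β (toTorusObservable (L + 1) (plaqCost0 (d := 4) ρ 1 2)) *
          (β * wilsonExpectation (L := L + 1) ρ β (toTorusObservable (L + 1) fun U =>
            plaqCost0 (d := 4) ρ 1 2 (timeShiftLG (G := G) n U))) := by ring
  rw [e3]
  refine habs.trans ?_
  -- arithmetic of the error terms
  have hpX : 0 ≤ Q.real {e | m < X' e} := measureReal_nonneg
  have hpY : 0 ≤ Q.real {e | m < Y' e} := measureReal_nonneg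
  have hexp : 0 ≤ Real.exp (-(m / 2)) := (Real.exp_pos _).le
  have hβκ : 0 ≤ β ^ κ := pow_nonneg hβ0.le κ
  have hsum : P.real {U | m < X U} + P.real {U | m < Y U} ≤ 2 * (C * β ^ κ * Real.exp (-(m / 2))) := by linarith
  have hstep : 2 * (2 * r.N * β) ^ 2 * (P.real {U | m < X U} + P.real {U | m < Y U} +
        Q.real {e | m < X' e} + Q.real {e | m < Y' e}) ≤
      (16 * (r.N : ℝ) ^ 2 * C + 1) * β ^ (κ + 2) * Real.exp (-(m / 2)) +
        8 * ((r.N : ℝ) * β) ^ 2 * (Q.real {e | m < X' e} + Q.real {e | m < Y' e}) := by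
    have e4 : 2 * (2 * r.N * β) ^ 2 * (P.real {U | m < X U} + P.real {U | m < Y U} +
          Q.real {e | m < X' e} + Q.real {e | m < Y' e}) =
        8 * ((r.N : ℝ) * β) ^ 2 * (P.real {U | m < X U} + P.real {U | m < Y U}) +
          8 * ((r.N : ℝ) * β) ^ 2 * (Q.real {e | m < X' e} + Q.real {e | m < Y' e}) := by ring
    rw [e4]
    have e5 : 8 * ((r.N : ℝ) * β) ^ 2 * (2 * (C * β ^ κ * Real.exp (-(m / 2)))) =
        16 * (r.N : ℝ) ^ 2 * C * β ^ (κ + 2) * Real.exp (-(m / 2)) := by ring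
    have h8 : 0 ≤ 8 * ((r.N : ℝ) * β) ^ 2 := by positivity
    have h9 := mul_le_mul_of_nonneg_left hsum h8
    rw [e5] at h9
    have h10 : 0 ≤ β ^ (κ + 2) * Real.exp (-(m / 2)) := by positivity
    nlinarith
  linarith

end Torus

end Summit.QuantumFields.YangMills.Theorems.EntropyBudgetEquipartition.CovTransfer

end
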